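import Summits.NavierStokesRegularity.NavierStokesRegularity.Theorems.EfficiencyFloorNearMaximiserBoundedAmplificationEarlyDeficit
import Summits.NavierStokesRegularity.NavierStokesRegularity.Theorems.EfficiencyFloorCoveringUpgrade
import HarnessLib

/-!
# Route `EfficiencyFloor`, rung `LerayFloorGap` (stmt-NavierStokesRegularity-25164, split gen 1): a MAXIMISER-FREE sufficient
# condition — the SATURATION EARLY-DEFICIT law implies `LerayFloorGap`, and the split's parts 25482 ∧ 25483 imply that law

Helper file (`--supports stmt-NavierStokesRegularity-25164`). The registered glue (stmt-25485, landed) reaches `LerayFloorGap`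
through the variational sub-tree: sharp budget (25481) → quantitative stability of Lu–Doering extremisers (25482, needs
ATTAINMENT of `c⋆`, see `…LerayFloorGapAttainment`, p824975) → bounded amplification near maximisers (25483 ⟺ EARLY DEFICIT,
p824714) → covering (25484). This file records the DYNAMICAL statement those parts jointly feed into the covering lemma, with no
extremiser, maximiser set, symmetry group or attainment question in it:

* **Saturation early-deficit law** `SED(c⋆)` (inline): there are `δ > 0`, `0 ≤ η < 1`, `θ > 0` such that along every maximal
  classical Leray–Hopf rapidly-decaying-datum solution, on a late window `[t₁,T)`, every slice `u(s)` that
  `(1−δ)`-SATURATES the cubic law (`(1−δ)(27c⋆⁴/(128ν³))Z³ ≤ 2S − 2ν·Pal`) is followed at the single instant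
  `s' = s + η·W(s)` (`W(s) = (64ν³/(27c⋆⁴))Z(u s)⁻²`) by `s' < T` and the margin `(1 − η + 2θ)·Z(u s)⁻² ≤ Z(u s')⁻²`
  — «near-extremal efficiency is not sustained for the fraction `η` of the would-be blow-up window, quantitatively».
* `lerayFloorGap_of_saturationEarlyDeficit` — `SED ⟹ Theses.EfficiencyFloor.LerayFloorGap` (BY NAME), via the landed
  `CoveringUpgrade` (`EfficiencyFloorCoveringUpgrade.efficiencyFloor_coveringUpgrade_proof`) with `A = √max((1−η)⁻¹,(2θ)⁻¹)` and the real-analysis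
  lemma `NearMaximiserBoundedAmplification.sq_le_of_earlyDeficit` (p824714); enstrophy positivity on the whole window from
  Leray's floor (`lintegral_curl_sq_pos`), monotonicity in the admissible constant as in the glue.
* `saturationEarlyDeficit_of_parts` — `NearSaturationNearMaximiser ∧ NearMaximiserBoundedAmplification ⟹ SED` (BY NAME): the
  variational parts are ONE mechanism for the dynamical law (near-saturation ⇒ near a maximiser ⇒ early deficit).

READING. `SED` is weaker than the conjunction 25482 ∧ 25483 it replaces (it survives non-attainment of `c⋆`, under which 25482
is false, p824975) and is exactly what the covering consumes; it is the natural re-lining point of the rung and the natural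
instrument row (one number per near-saturated slice of a candidate-singular run). HONEST FRAMING: implications between OPEN
statements about a HYPOTHETICAL blow-up; `SED`, `LerayFloorGap`, 25482, 25483, `ProductionEfficiencyDecay` and Navier–Stokes
regularity stay OPEN; no summit statement is proved. [folklore]
-/

-- the problem directory repeats the summit name (`NavierStokesRegularity/NavierStokesRegularity`)
set_option linter.dupNamespace false

noncomputable section

namespace Summit.NavierStokesRegularity.NavierStokesRegularity.Theorems

namespace LerayFloorGap

namespace SaturationEarlyDeficit

open Set MeasureTheory Filter Topology Function
open scoped InnerProductSpace ENNReal
open Literature.Analysis.FluidPDE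
open Summit.NavierStokesRegularity.NavierStokesRegularity.Theorems.ProductionEfficiencyDecay
open Summit.NavierStokesRegularity.NavierStokesRegularity.Theorems.NearMaximiserBoundedAmplification

/-- **`SED ⟹ LerayFloorGap`.** The saturation early-deficit law for the sharp one-sided Lu–Doering constant implies the
route decl `Theses.EfficiencyFloor.LerayFloorGap` (one `θ₀ < 1` for every admissible constant `c`). [folklore] -/
theorem lerayFloorGap_of_saturationEarlyDeficit
    (hSED : ∀ c : ℝ, (0 < c ∧ (∀ v : EuclideanSpace ℝ (Fin 3) → EuclideanSpace ℝ (Fin 3), (ContDiff ℝ (⊤ : ℕ∞) v ∧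
      Literature.Analysis.FluidPDE.VectorCalculus.IsDivFree v ∧ (∫⁻ x, ‖iteratedFDeriv ℝ 0 v x‖ₑ ^ 2 < ⊤) ∧ (∫⁻ x,
      ‖iteratedFDeriv ℝ 1 v x‖ₑ ^ 2 < ⊤) ∧ (∫⁻ x, ‖iteratedFDeriv ℝ 2 v x‖ₑ ^ 2 < ⊤)) → (∫ x,
      ⟪Literature.Analysis.FluidPDE.curl v x, fderiv ℝ v x (Literature.Analysis.FluidPDE.curl v x)⟫_ℝ) ≤ c * (∫ x,
      ‖Literature.Analysis.FluidPDE.curl v x‖ ^ 2) ^ (3 / 4 : ℝ) * (∫ x,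
      Literature.Analysis.FluidPDE.frobeniusNormSq (fderiv ℝ (Literature.Analysis.FluidPDE.curl v) x)) ^ (3 / 4 :
      ℝ)) ∧ ∀ c' : ℝ, (∀ w : EuclideanSpace ℝ (Fin 3) → EuclideanSpace ℝ (Fin 3), (ContDiff ℝ (⊤ : ℕ∞) w ∧
      Literature.Analysis.FluidPDE.VectorCalculus.IsDivFree w ∧ (∫⁻ x, ‖iteratedFDeriv ℝ 0 w x‖ₑ ^ 2 < ⊤) ∧ (∫⁻ x,
      ‖iteratedFDeriv ℝ 1 w x‖ₑ ^ 2 < ⊤) ∧ (∫⁻ x, ‖iteratedFDeriv ℝ 2 w x‖ₑ ^ 2 < ⊤)) → (∫ x,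
      ⟪Literature.Analysis.FluidPDE.curl w x, fderiv ℝ w x (Literature.Analysis.FluidPDE.curl w x)⟫_ℝ) ≤ c' * (∫
      x, ‖Literature.Analysis.FluidPDE.curl w x‖ ^ 2) ^ (3 / 4 : ℝ) * (∫ x,
      Literature.Analysis.FluidPDE.frobeniusNormSq (fderiv ℝ (Literature.Analysis.FluidPDE.curl w) x)) ^ (3 / 4 :
      ℝ)) → c ≤ c') → ∃ δ η θ : ℝ, 0 < δ ∧ 0 ≤ η ∧ η < 1 ∧ 0 < θ ∧ ∀ (ν T : ℝ), 0 < ν → 0 < T → ∀ (u : ℝ →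
      EuclideanSpace ℝ (Fin 3) → EuclideanSpace ℝ (Fin 3)) (p : ℝ → EuclideanSpace ℝ (Fin 3) → ℝ),
      Literature.Analysis.FluidPDE.IsMaximalSmoothSolution ν 0 u p T → Literature.Analysis.FluidPDE.IsLerayHopfOn
      T ν 0 (u 0) u → Literature.Analysis.FluidPDE.HasRapidSpatialDecay (u 0) → ∃ t₁ ∈ Set.Ioo 0 T, ∀ s ∈ Set.Ico
      t₁ T, (1 - δ) * (27 * c ^ 4 / (128 * ν ^ 3)) * (∫ x, ‖Literature.Analysis.FluidPDE.curl (u s) x‖ ^ 2) ^ 3 ≤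
      2 * (∫ x, ⟪Literature.Analysis.FluidPDE.curl (u s) x, fderiv ℝ (u s) x (Literature.Analysis.FluidPDE.curl (u
      s) x)⟫_ℝ) - 2 * ν * (∫ x, Literature.Analysis.FluidPDE.frobeniusNormSq (fderiv ℝ
      (Literature.Analysis.FluidPDE.curl (u s)) x)) → s + η * (64 * ν ^ 3 / (27 * c ^ 4) * (∫ x,
      ‖Literature.Analysis.FluidPDE.curl (u s) x‖ ^ 2)⁻¹ ^ 2) < T ∧ (1 - η + 2 * θ) * (∫ x,
      ‖Literature.Analysis.FluidPDE.curl (u s) x‖ ^ 2)⁻¹ ^ 2 ≤ (∫ x, ‖Literature.Analysis.FluidPDE.curl (u (s + η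
      * (64 * ν ^ 3 / (27 * c ^ 4) * (∫ x, ‖Literature.Analysis.FluidPDE.curl (u s) x‖ ^ 2)⁻¹ ^ 2))) x‖ ^ 2)⁻¹ ^ 2) :
    Summit.NavierStokesRegularity.NavierStokesRegularity.Theses.EfficiencyFloor.LerayFloorGap := by
  obtain ⟨cs, hsharp, hbud⟩ := efficiencyFloor_sharpLuDoeringBudget_proof
  have hcs : 0 < cs := hsharp.1
  obtain ⟨δ, η, θ, hδ, hη0, hη1, hθ, hlaw⟩ := hSED cs hsharp
  -- the amplification constant of the early-deficit lemma
  have h1η : 0 < 1 - η := by linarith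
  have hM1 : 1 ≤ max (1 - η)⁻¹ (2 * θ)⁻¹ :=
    le_max_of_le_left (one_le_inv_iff₀.2 ⟨h1η, by linarith⟩)
  have hM0 : 0 ≤ max (1 - η)⁻¹ (2 * θ)⁻¹ := zero_le_one.trans hM1
  set A : ℝ := Real.sqrt (max (1 - η)⁻¹ (2 * θ)⁻¹) with hA
  have hA1 : 1 ≤ A := by rw [hA]; exact Real.one_le_sqrt.2 hM1
  have hA0 : 0 ≤ A := zero_le_one.trans hA1
  have hA2 : A ^ 2 = max (1 - η)⁻¹ (2 * θ)⁻¹ := by rw [hA]; exact Real.sq_sqrt hM0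
  obtain ⟨θ₀, hθ₀0, hθ₀1, hcov⟩ := EfficiencyFloorCoveringUpgrade.efficiencyFloor_coveringUpgrade_proof δ A hδ hA1
  refine ⟨θ₀, hθ₀0, hθ₀1, ?_⟩
  intro c hc hcadm ν T hν hT u p hmax hLH hdec
  have hcsc : cs ≤ c := hsharp.2.2 c (fun v hv => hcadm v hv.1 hv.2.1 hv.2.2.1 hv.2.2.2.1 hv.2.2.2.2)
  obtain ⟨Zr, D, hB⟩ := hbud ν T hν hT u p hmax hLH hdec
  set K : ℝ := 27 * cs ^ 4 / (128 * ν ^ 3) with hKdef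
  have hK : 0 < K := by positivity
  have hKinv : (2 * K)⁻¹ = 64 * ν ^ 3 / (27 * cs ^ 4) := by
    rw [hKdef]; field_simp; ring
  obtain ⟨t₁, ht₁, hwinlaw⟩ := hlaw ν T hν hT u p hmax hLH hdec
  have hIoo : ∀ s ∈ Set.Ico t₁ T, s ∈ Set.Ioo 0 T := fun s hs => ⟨ht₁.1.trans_le hs.1, hs.2⟩
  -- positivity of `Zr` on `[t₁,T)` (Leray floor) and divergence at `T`
  have hpos : ∀ s ∈ Set.Ico t₁ T, 0 < Zr s := fun s hs => by
    have h1 := lintegral_curl_sq_pos hν hT hmax hLH hdec s ⟨(hIoo s hs).1.le, hs.2⟩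
    rw [(hB s (hIoo s hs)).1] at h1
    exact ENNReal.ofReal_pos.1 h1
  have hunb : ∀ N : ℝ, ∀ᶠ t in nhdsWithin T (Set.Iio T), N ≤ Zr t := by
    intro N
    have h1N := Theorems.BlowupEnstrophyUnbounded.main hν hT hmax hLH hdec N
    have h2N : ∀ᶠ t in nhdsWithin T (Set.Iio T), t ∈ Set.Ioo 0 T := Ioo_mem_nhdsLT hT
    filter_upwards [h1N, h2N] with t hNt ht
    rw [(hB t ht).1] at hNt
    exact (ENNReal.ofReal_le_ofReal_iff (hB t ht).2.1).1 hNt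
  have hgap := hcov K hK Zr D t₁ T ht₁.2
    (fun s hs => ⟨hpos s hs, (hB s (hIoo s hs)).2.2.2.2.1, (hB s (hIoo s hs)).2.2.2.2.2.2⟩)
    hunb
    (by
      intro s hs hsat t ht hwin
      have hsI := hIoo s hs
      obtain ⟨hZs_eq, hZs_nn, hAdm_s, hZs_ens, hder_s, hD_s, hcube_s⟩ := hB s hsI
      -- the slice `u s` is `(1−δ)`-saturated in the route's vocabulary
      have hsat' : (1 - δ) * (27 * cs ^ 4 / (128 * ν ^ 3)) * (∫ x, ‖curl (u s) x‖ ^ 2) ^ 3 ≤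
          2 * (∫ x, ⟪curl (u s) x, fderiv ℝ (u s) x (curl (u s) x)⟫_ℝ) -
            2 * ν * (∫ x, frobeniusNormSq (fderiv ℝ (curl (u s)) x)) := by
        rw [← hZs_ens, ← hD_s]; simpa [hKdef] using hsat
      obtain ⟨hs'T, hdef⟩ := hwinlaw s hs hsat'
      rw [← hZs_ens, ← hKinv] at hs'T hdef
      have hW0 : 0 ≤ η * ((2 * K)⁻¹ * (Zr s)⁻¹ ^ 2) := by positivity
      have hs'I : s + η * ((2 * K)⁻¹ * (Zr s)⁻¹ ^ 2) ∈ Set.Ioo 0 T := ⟨by linarith [hsI.1], hs'T⟩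
      have hZs' : (∫ x, ‖curl (u (s + η * ((2 * K)⁻¹ * (Zr s)⁻¹ ^ 2))) x‖ ^ 2) =
          Zr (s + η * ((2 * K)⁻¹ * (Zr s)⁻¹ ^ 2)) := ((hB _ hs'I).2.2.2.1).symm
      rw [hZs'] at hdef
      have hposI : ∀ τ ∈ Set.Ico s T, 0 < Zr τ := fun τ hτ => hpos τ ⟨hs.1.trans hτ.1, hτ.2⟩
      have hderI : ∀ τ ∈ Set.Ico s T, ∃ D' : ℝ, HasDerivAt Zr D' τ ∧ D' ≤ K * Zr τ ^ 3 := fun τ hτ =>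
        ⟨D τ, (hB τ (hIoo τ ⟨hs.1.trans hτ.1, hτ.2⟩)).2.2.2.2.1,
          (hB τ (hIoo τ ⟨hs.1.trans hτ.1, hτ.2⟩)).2.2.2.2.2.2⟩
      have hsq := sq_le_of_earlyDeficit hK hη0 hη1 hθ hposI hderI le_rfl hdef ht.1 ht.2 hwin
      rw [← hA2, ← mul_pow] at hsq
      have hZt0 : 0 ≤ Zr t := (hposI t ⟨ht.1, ht.2⟩).le
      have hAZ : 0 ≤ A * Zr s := mul_nonneg hA0 (hpos s hs).le
      exact (pow_le_pow_iff_left₀ hZt0 hAZ two_ne_zero).1 hsq)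
  have hIco : ∀ᶠ t in nhdsWithin T (Set.Iio T), t ∈ Set.Ico t₁ T := Ico_mem_nhdsLT ht₁.2
  filter_upwards [hIco] with t ht
  have htI := hIoo t ht
  rw [(hB t htI).1, ENNReal.toReal_ofReal (hB t htI).2.1]
  have h2K : 2 * K ≤ 27 * c ^ 4 / (64 * ν ^ 3) := by
    have hc4 : cs ^ 4 ≤ c ^ 4 := pow_le_pow_left₀ hcs.le hcsc 4
    rw [hKdef, show 2 * (27 * cs ^ 4 / (128 * ν ^ 3)) = 27 * cs ^ 4 / (64 * ν ^ 3) by ring]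
    have hν3 : 0 < 64 * ν ^ 3 := by positivity
    exact div_le_div_of_nonneg_right (by nlinarith) hν3.le
  calc (Zr t)⁻¹ ^ 2 ≤ θ₀ * (2 * K) * (T - t) := hgap t ht
    _ ≤ θ₀ * (27 * c ^ 4 / (64 * ν ^ 3)) * (T - t) := by
        apply mul_le_mul_of_nonneg_right _ (sub_nonneg.2 ht.2.le)
        exact mul_le_mul_of_nonneg_left h2K hθ₀0

/-- **The variational parts imply the saturation early-deficit law**: `NearSaturationNearMaximiser` (stmt-25482) and
`NearMaximiserBoundedAmplification` (stmt-25483, in its early-deficit form p824714) give `SED` with the `δ` of 25482 at the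
`ε` of 25483 and the `(η, θ)` of the early-deficit law (window `[t₁,T) = [T/2,T)`, any would do). [folklore] -/
theorem saturationEarlyDeficit_of_parts
    (h2 : Summit.NavierStokesRegularity.NavierStokesRegularity.Theses.EfficiencyFloor.NearSaturationNearMaximiser)
    (h3 : Summit.NavierStokesRegularity.NavierStokesRegularity.Theses.EfficiencyFloor.NearMaximiserBoundedAmplification) :
    ∀ c : ℝ, (0 < c ∧ (∀ v : EuclideanSpace ℝ (Fin 3) → EuclideanSpace ℝ (Fin 3), (ContDiff ℝ (⊤ : ℕ∞) v ∧
      Literature.Analysis.FluidPDE.VectorCalculus.IsDivFree v ∧ (∫⁻ x, ‖iteratedFDeriv ℝ 0 v x‖ₑ ^ 2 < ⊤) ∧ (∫⁻ x,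
      ‖iteratedFDeriv ℝ 1 v x‖ₑ ^ 2 < ⊤) ∧ (∫⁻ x, ‖iteratedFDeriv ℝ 2 v x‖ₑ ^ 2 < ⊤)) → (∫ x,
      ⟪Literature.Analysis.FluidPDE.curl v x, fderiv ℝ v x (Literature.Analysis.FluidPDE.curl v x)⟫_ℝ) ≤ c * (∫ x,
      ‖Literature.Analysis.FluidPDE.curl v x‖ ^ 2) ^ (3 / 4 : ℝ) * (∫ x,
      Literature.Analysis.FluidPDE.frobeniusNormSq (fderiv ℝ (Literature.Analysis.FluidPDE.curl v) x)) ^ (3 / 4 :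
      ℝ)) ∧ ∀ c' : ℝ, (∀ w : EuclideanSpace ℝ (Fin 3) → EuclideanSpace ℝ (Fin 3), (ContDiff ℝ (⊤ : ℕ∞) w ∧
      Literature.Analysis.FluidPDE.VectorCalculus.IsDivFree w ∧ (∫⁻ x, ‖iteratedFDeriv ℝ 0 w x‖ₑ ^ 2 < ⊤) ∧ (∫⁻ x,
      ‖iteratedFDeriv ℝ 1 w x‖ₑ ^ 2 < ⊤) ∧ (∫⁻ x, ‖iteratedFDeriv ℝ 2 w x‖ₑ ^ 2 < ⊤)) → (∫ x,
      ⟪Literature.Analysis.FluidPDE.curl w x, fderiv ℝ w x (Literature.Analysis.FluidPDE.curl w x)⟫_ℝ) ≤ c' * (∫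
      x, ‖Literature.Analysis.FluidPDE.curl w x‖ ^ 2) ^ (3 / 4 : ℝ) * (∫ x,
      Literature.Analysis.FluidPDE.frobeniusNormSq (fderiv ℝ (Literature.Analysis.FluidPDE.curl w) x)) ^ (3 / 4 :
      ℝ)) → c ≤ c') → ∃ δ η θ : ℝ, 0 < δ ∧ 0 ≤ η ∧ η < 1 ∧ 0 < θ ∧ ∀ (ν T : ℝ), 0 < ν → 0 < T → ∀ (u : ℝ →
      EuclideanSpace ℝ (Fin 3) → EuclideanSpace ℝ (Fin 3)) (p : ℝ → EuclideanSpace ℝ (Fin 3) → ℝ),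
      Literature.Analysis.FluidPDE.IsMaximalSmoothSolution ν 0 u p T → Literature.Analysis.FluidPDE.IsLerayHopfOn
      T ν 0 (u 0) u → Literature.Analysis.FluidPDE.HasRapidSpatialDecay (u 0) → ∃ t₁ ∈ Set.Ioo 0 T, ∀ s ∈ Set.Ico
      t₁ T, (1 - δ) * (27 * c ^ 4 / (128 * ν ^ 3)) * (∫ x, ‖Literature.Analysis.FluidPDE.curl (u s) x‖ ^ 2) ^ 3 ≤
      2 * (∫ x, ⟪Literature.Analysis.FluidPDE.curl (u s) x, fderiv ℝ (u s) x (Literature.Analysis.FluidPDE.curl (u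
      s) x)⟫_ℝ) - 2 * ν * (∫ x, Literature.Analysis.FluidPDE.frobeniusNormSq (fderiv ℝ
      (Literature.Analysis.FluidPDE.curl (u s)) x)) → s + η * (64 * ν ^ 3 / (27 * c ^ 4) * (∫ x,
      ‖Literature.Analysis.FluidPDE.curl (u s) x‖ ^ 2)⁻¹ ^ 2) < T ∧ (1 - η + 2 * θ) * (∫ x,
      ‖Literature.Analysis.FluidPDE.curl (u s) x‖ ^ 2)⁻¹ ^ 2 ≤ (∫ x, ‖Literature.Analysis.FluidPDE.curl (u (s + η
      * (64 * ν ^ 3 / (27 * c ^ 4) * (∫ x, ‖Literature.Analysis.FluidPDE.curl (u s) x‖ ^ 2)⁻¹ ^ 2))) x‖ ^ 2)⁻¹ ^ 2 := by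
  intro c hsharp
  obtain ⟨η, θ, ε, hη0, hη1, hθ, hε, hED⟩ := earlyDeficit_of_nearMaximiserBoundedAmplification h3 c hsharp
  obtain ⟨δ, hδ, h2'⟩ := h2 c ε hsharp hε
  refine ⟨δ, η, θ, hδ, hη0, hη1, hθ, fun ν T hν hT u p hmax hLH hdec => ?_⟩
  refine ⟨T / 2, ⟨by linarith, by linarith⟩, fun s hs hsat => ?_⟩
  have hsI : s ∈ Set.Ioo 0 T := ⟨by linarith [hs.1], hs.2⟩
  obtain ⟨c₀, hsharp₀, hbud⟩ := efficiencyFloor_sharpLuDoeringBudget_proof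
  obtain ⟨Zr, D, hB⟩ := hbud ν T hν hT u p hmax hLH hdec
  obtain ⟨hZs_eq, -, hAdm_s, hZs_ens, -, -, -⟩ := hB s hsI
  have hpos : 0 < ∫ x, ‖curl (u s) x‖ ^ 2 := by
    have h1 := lintegral_curl_sq_pos hν hT hmax hLH hdec s ⟨hsI.1.le, hsI.2⟩
    rw [hZs_eq] at h1
    rw [← hZs_ens]
    exact ENNReal.ofReal_pos.1 h1
  obtain ⟨m, hm, hclose⟩ := h2' ν hν (u s) hAdm_s hpos hsat
  exact hED ν T hν hT u p hmax hLH hdec s hsI m hm hclose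

end SaturationEarlyDeficit

end LerayFloorGap

end Summit.NavierStokesRegularity.NavierStokesRegularity.Theorems

end
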